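import Literature.NumberTheory.EllipticCurves.ModularParametrizationBCDTProofs
import Literature.NumberTheory.EllipticCurves.EichlerShimuraConstructionReductionProofs
import Literature.NumberTheory.EllipticCurves.ModularCurveManinConstantProofs
import HarnessLib

/-!
# `nonempty_modularParametrizationData` is exactly "(2) + rational Manin constant": the trust base
# of the fact after the discharge of the lattice bookkeeping

A `…Proofs` companion (theorems only: no definitions, no named facts, no instances) of
`Literature/NumberTheory/EllipticCurves/ModularCurve.lean`, landed by the tenured seat of the named
fact `Literature.NumberTheory.EllipticCurves.ModularForms.nonempty_modularParametrizationData`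
(Breuil–Conrad–Diamond–Taylor 2001, Thm. A in the analytic form (6) of p. 845 for `X₀(N)`: every
elliptic curve over `ℚ`, in a globally minimal model `W` of conductor `N_E`, admits a
`ModularParametrizationData W N_E` — its newform, a Néron lattice, the uniformisation
`ℂ →+ E(ℂ)`, a nonzero integer `c` with `c Λ_f ⊆ Λ_E`, and the modular degree).

Since `ModularParametrizationBCDTProofs.lean` two inputs of the printed step "(2) ⇒ (6)"
became theorems of the tree: the lattice bookkeeping for `ℚ`-isogenies
(`neronLattice_commensurable_of_isIsogenous_holds`, `EichlerShimuraConstructionLatticeProofs.lean`: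
Silverman AEC VI.4.1, VI.5.3 with III.5) and strong multiplicity one for `Γ₀(N)`-newforms across
levels (`IsNewform0.level_eq_of_heckeEigenvalue_eq_holds`, `IsNewform0.eq_of_heckeEigenvalue_eq_holds`:
Atkin–Lehner 1970, Thm. 4). This file records what that leaves of the fact:

* `exists_maninConstant_ne_zero_of_nonempty_modularParametrizationData` — the target fact
  **implies** the commensurability fact `IsNewformOf.exists_maninConstant_ne_zero`
  (`ModularParametrizationDegree.lean`: for *every* model `W/ℚ` with newform `f` and every
  Néron-type period pair `L` of `W` there is `c ∈ ℤ ∖ {0}` with `c Λ_f ⊆ Λ_L`). Given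
  `IsNewformOf W f` (`f` of level `N`) and `L`: the datum `D` of a global minimal model `C • W`
  (`hasGlobalMinimalModel_rat_holds`) carries a newform `D.f` of level `N_{C • W}` with the same
  coefficients `aₙ(D.f) = aₙ(C • W) = aₙ(W) = aₙ(f)` (`LFunction_smul`), so `N = N_{C • W}` and
  `f = D.f` by strong multiplicity one; `D.c Λ_f ⊆ Λ_{D.L}` with `D.c ≠ 0`
  (`maninConstant_ne_zero_holds`, Edixhoven 1991 §1), and `a Λ_{D.L} ⊆ Λ_L` for a nonzero
  integer `a` because `C • W ~ W` over `ℚ` (`isIsogenous_of_smul`,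
  `neronLattice_commensurable_of_isIsogenous_holds`); hence `(a · D.c) Λ_f ⊆ Λ_L`.
* `nonempty_modularParametrizationData_iff` — **unconditionally**,
  `nonempty_modularParametrizationData ↔ exists_isNewformOf ∧ IsNewformOf.exists_maninConstant_ne_zero`:
  the fact is *exactly* the conjunction of the Modularity Theorem in the form (2)
  (`exists_isNewformOf`, BCDT Thm. A) and the rationality of the Manin constant of every curve in
  the isogeny class (the residue of "a construction of Shimura and a theorem of Faltings",
  p. 845); the remaining inputs of (6) — the Néron lattice (AEC VI.5.1), the uniformisation
  (AEC VI.3.6(b)) and the modular degree (Riemann-surface theory of `X₀(N)`) — being theorems of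
  the tree (`nonempty_modularParametrizationData_of_three_facts`,
  `IsNeronLatticeOf.exists_uniformize_holds`). This is the exact residual trust base of the fact.
* `nonempty_modularParametrizationData_of_theoremB_of_CDT_of_maninConstant` — the printed proof
  of Theorem A (Thm. 2.2.2 = Thm. B + [CDT, Thm. 7.2.4]) threaded to the parametrisation with the
  smallest hypothesis set now available: `BCDT.theoremB`, `BCDT.CDT_theorem_7_2_4` and
  `IsNewformOf.exists_maninConstant_ne_zero`.
* `nonempty_modularParametrizationData_of_theoremB_of_CDT'`,
  `nonempty_modularParametrizationData_iff_exists_isNewformOf'`,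
  `nonempty_modularParametrizationData_iff_forall_isModular'` — the statements of
  `ModularParametrizationBCDTProofs.lean` with the hypothesis
  `neronLattice_commensurable_of_isIsogenous` removed (fed by its discharge).

## References

* C. Breuil, B. Conrad, F. Diamond, R. Taylor, *On the modularity of elliptic curves over `ℚ`:
  wild 3-adic exercises*, J. Amer. Math. Soc. 14 (2001), 843–939: Theorem A (p. 843 = PDF p. 2),
  the list (1)–(6) and "(2) ⇒ (6)" (p. 845 = PDF p. 4), Thm. 2.2.2 (PDF p. 21). [BCDTJAMS2001]
* A. O. L. Atkin, J. Lehner, *Hecke operators on `Γ₀(m)`*, Math. Ann. 185 (1970), Thm. 4.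
  [AtkinLehner1970]
* B. Edixhoven, *On the Manin constants of modular elliptic curves*, in *Arithmetic algebraic
  geometry (Texel, 1989)*, Progr. Math. 89 (1991), §1. [EdixhovenManin1991]
* J. H. Silverman, *The Arithmetic of Elliptic Curves*, 2nd ed., GTM 106 (2009), Thm. VI.4.1,
  Thm. VI.5.3, III.5; VIII.8.3 (global minimal models over `ℚ`). [SilvermanAEC2009]
-/

noncomputable section

open scoped MatrixGroups ModularForm

open CongruenceSubgroup

namespace Literature.NumberTheory.EllipticCurves.ModularForms

open Literature.NumberTheory.Automorphic

/-! ### The target fact yields the rational Manin constant of every curve in the isogeny class -/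

section ManinConstant

/-- **`nonempty_modularParametrizationData` implies `IsNewformOf.exists_maninConstant_ne_zero`.**
Let `W/ℚ` be elliptic with newform `f ∈ S₂(Γ₀(N))` (`IsNewformOf W f`) and let `L` be a
Néron-type period pair of `W`. Choose a global minimal model `C • W`
(`hasGlobalMinimalModel_rat_holds`, Silverman AEC VIII.8.3) and its parametrisation datum `D`
(the hypothesis, at level `N_{C • W}`). The newform `D.f` has `aₙ(D.f) = aₙ(C • W) = aₙ(W) = aₙ(f)`
for all `n` (`LFunction_smul`), so the `T_p`-eigenvalues of `f` and `D.f` agree at every prime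
(`heckeEigenvalue_eq_coeff_of_isNormalized`) and strong multiplicity one gives `N = N_{C • W}`,
`f = D.f` (Atkin–Lehner 1970, Thm. 4: `IsNewform0.level_eq_of_heckeEigenvalue_eq_holds`,
`IsNewform0.eq_of_heckeEigenvalue_eq_holds`). Now `D.c Λ_f ⊆ Λ_{D.L}` with `D.c ≠ 0`
(`maninConstant_ne_zero_holds`), and `a Λ_{D.L} ⊆ Λ_L` for a nonzero integer `a` since
`C • W ~ W` over `ℚ` (`isIsogenous_of_smul`) and `ℚ`-isogenous curves have commensurable
Néron-type lattices (`neronLattice_commensurable_of_isIsogenous_holds`, AEC VI.4.1, VI.5.3,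
III.5); so `c = a · D.c` works. [cite: BCDTJAMS2001, p. 845, (6) ⇒ (2) with "(2) ⇒ (6)"]
[cite: AtkinLehner1970, Thm. 4] -/
theorem exists_maninConstant_ne_zero_of_nonempty_modularParametrizationData
    (h : nonempty_modularParametrizationData) : IsNewformOf.exists_maninConstant_ne_zero := by
  intro W _ N _ f hf L hL
  obtain ⟨C, hC⟩ := WeierstrassCurve.hasGlobalMinimalModel_rat_holds W
  haveI := hC
  haveI : NeZero ((C • W).conductorNorm ℤ) :=
    ⟨(WeierstrassCurve.conductorNorm_pos_holds (C • W)).ne'⟩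
  obtain ⟨D⟩ := h (C • W)
  -- `f` and `D.f` have the same Hecke eigenvalues at every prime
  have hfin : {p : ℕ | p.Prime ∧ heckeEigenvalue f p ≠ heckeEigenvalue D.f p}.Finite := by
    refine Set.finite_empty.subset ?_
    rintro p ⟨hp, hne⟩
    apply hne
    rw [heckeEigenvalue_eq_coeff_of_isNormalized hf.1.2.2 hp (hf.1.2.1 p hp),
      heckeEigenvalue_eq_coeff_of_isNormalized D.isNewformOf.1.2.2 hp (D.isNewformOf.1.2.1 p hp)]
    change cuspCoeff f p = cuspCoeff D.f p
    rw [hf.2 p, D.isNewformOf.2 p, WeierstrassCurve.LFunction_smul]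
  -- strong multiplicity one: same level, same form
  have hN : N = (C • W).conductorNorm ℤ :=
    IsNewform0.level_eq_of_heckeEigenvalue_eq_holds hf.1 D.isNewformOf.1 hfin
  subst hN
  have hfg : f = D.f := IsNewform0.eq_of_heckeEigenvalue_eq_holds hf.1 D.isNewformOf.1 hfin
  -- lattice transfer `Λ_{D.L} → Λ_L` along `C • W ~ W`
  obtain ⟨a, ha0, ha⟩ := neronLattice_commensurable_of_isIsogenous_holds
    (WeierstrassCurve.isIsogenous_of_smul W C) D.isNeronLattice hL
  refine ⟨a * D.c, mul_ne_zero ha0 D.maninConstant_ne_zero_holds, fun z hz ↦ ?_⟩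
  rw [Int.cast_mul, mul_assoc]
  rw [hfg] at hz
  exact ha _ (D.smul_periodLattice_le z hz)

/-- **The exact residual trust base of `nonempty_modularParametrizationData`.** Unconditionally,
the fact is equivalent to the conjunction of the Modularity Theorem in the form (2) of
Breuil–Conrad–Diamond–Taylor (`exists_isNewformOf`, Thm. A) and the commensurability
`c Λ_f ⊆ Λ_E`, `c ∈ ℤ ∖ {0}`, for every curve with newform `f`
(`IsNewformOf.exists_maninConstant_ne_zero` — in print: the Eichler–Shimura construction with the
rationality of the Manin constant, Faltings' isogeny theorem, and the now-proved lattice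
bookkeeping). ⇒: `exists_isNewformOf_of_nonempty_modularParametrizationData` ((6) ⇒ (2)) and
`exists_maninConstant_ne_zero_of_nonempty_modularParametrizationData`; ⇐:
`nonempty_modularParametrizationData_of_three_facts` with the uniformisation theorem of the tree
(`IsNeronLatticeOf.exists_uniformize_holds`, AEC VI.3.6(b)) — the Néron lattice (AEC VI.5.1) and
the modular degree being proved there as well.
[cite: BCDTJAMS2001, Thm. A with p. 845, (2) ⇔ (6)] -/
theorem nonempty_modularParametrizationData_iff :
    nonempty_modularParametrizationData ↔
      exists_isNewformOf ∧ IsNewformOf.exists_maninConstant_ne_zero :=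
  ⟨fun h ↦ ⟨exists_isNewformOf_of_nonempty_modularParametrizationData h,
      exists_maninConstant_ne_zero_of_nonempty_modularParametrizationData h⟩,
    fun h ↦ nonempty_modularParametrizationData_of_three_facts h.1
      IsNeronLatticeOf.exists_uniformize_holds h.2⟩

/-- `nonempty_modularParametrizationData` from modularity (2) and the rational Manin constant
alone (the ⇐ half of `nonempty_modularParametrizationData_iff`, curried).
[cite: BCDTJAMS2001, p. 845, (2) ⇒ (6)] -/
theorem nonempty_modularParametrizationData_of_exists_isNewformOf (h₁ : exists_isNewformOf)
    (ha : IsNewformOf.exists_maninConstant_ne_zero) : nonempty_modularParametrizationData :=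
  nonempty_modularParametrizationData_iff.mpr ⟨h₁, ha⟩

end ManinConstant

/-! ### Theorem A threaded to the parametrisation, with the reduced hypothesis sets -/

section TheoremA

/-- **`nonempty_modularParametrizationData` from Theorem B, CDT Thm. 7.2.4 and the rational
Manin constant** — the printed proof of Breuil–Conrad–Diamond–Taylor's Theorem A (§2.2:
Thm. 2.2.2 = Thm. 2.2.1 + [CDT, Thm. 7.2.4]; `BCDT.exists_isNewformOf_of_theoremB_of_CDT`)
followed by "(2) ⇒ (6)" (p. 845) in the form `nonempty_modularParametrizationData_of_exists_isNewformOf`.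
Hypotheses: `BCDT.theoremB` (BCDT Thm. B), `BCDT.CDT_theorem_7_2_4` (Conrad–Diamond–Taylor 1999,
Thm. 7.2.4) and `IsNewformOf.exists_maninConstant_ne_zero`; nothing else.
[cite: BCDTJAMS2001, Theorem A, via Thm. 2.2.2 (§2.2) and p. 845 (2) ⇒ (6)] -/
theorem nonempty_modularParametrizationData_of_theoremB_of_CDT_of_maninConstant
    (hB : BCDT.theoremB) (hCDT : BCDT.CDT_theorem_7_2_4)
    (ha : IsNewformOf.exists_maninConstant_ne_zero) : nonempty_modularParametrizationData :=
  nonempty_modularParametrizationData_of_exists_isNewformOf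
    (BCDT.exists_isNewformOf_of_theoremB_of_CDT hB hCDT) ha

/-- **`nonempty_modularParametrizationData` from Theorem B, CDT Thm. 7.2.4, the construction of
Shimura and the theorem of Faltings** (`nonempty_modularParametrizationData_of_theoremB_of_CDT`
of `ModularParametrizationBCDTProofs.lean` with the lattice bookkeeping
`neronLattice_commensurable_of_isIsogenous` supplied by its discharge
`neronLattice_commensurable_of_isIsogenous_holds`). Hypotheses: `BCDT.theoremB`,
`BCDT.CDT_theorem_7_2_4`, `eichlerShimuraConstruction` (Knapp 1993, Thm. 11.74 with Thm. 12.8;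
Agashe–Ribet–Stein 2006, §2) and `WeierstrassCurve.isIsogenous_iff_frobeniusTrace_eq`
(Faltings 1983). [cite: BCDTJAMS2001, Theorem A, via Thm. 2.2.2 (§2.2) and p. 845 (2) ⇒ (6)] -/
theorem nonempty_modularParametrizationData_of_theoremB_of_CDT' (hB : BCDT.theoremB)
    (hCDT : BCDT.CDT_theorem_7_2_4) (hES : eichlerShimuraConstruction)
    (hF : WeierstrassCurve.isIsogenous_iff_frobeniusTrace_eq) :
    nonempty_modularParametrizationData :=
  nonempty_modularParametrizationData_of_theoremB_of_CDT hB hCDT hES hF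
    neronLattice_commensurable_of_isIsogenous_holds

end TheoremA

/-! ### (2) ⇔ (6) granted the construction of Shimura and the theorem of Faltings only -/

section Equivalence

/-- **(2) ⇔ (6)** (Breuil–Conrad–Diamond–Taylor 2001, p. 845) granted the Eichler–Shimura
construction and Faltings' isogeny theorem only
(`nonempty_modularParametrizationData_iff_exists_isNewformOf` with the lattice bookkeeping
discharged). [cite: BCDTJAMS2001, p. 845, (2) ⇔ (6)] -/
theorem nonempty_modularParametrizationData_iff_exists_isNewformOf'
    (hES : eichlerShimuraConstruction)
    (hF : WeierstrassCurve.isIsogenous_iff_frobeniusTrace_eq) :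
    nonempty_modularParametrizationData ↔ exists_isNewformOf :=
  nonempty_modularParametrizationData_iff_exists_isNewformOf hES hF
    neronLattice_commensurable_of_isIsogenous_holds

/-- The same equivalence with (2) spelled "every elliptic curve over `ℚ` is modular"
(`BCDT.IsModular`). [cite: BCDTJAMS2001, p. 845, (2) ⇔ (6)] -/
theorem nonempty_modularParametrizationData_iff_forall_isModular'
    (hES : eichlerShimuraConstruction)
    (hF : WeierstrassCurve.isIsogenous_iff_frobeniusTrace_eq) :
    nonempty_modularParametrizationData ↔
      ∀ (W : WeierstrassCurve ℚ) [W.IsElliptic] [NeZero (W.conductorNorm ℤ)], BCDT.IsModular W :=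
  nonempty_modularParametrizationData_iff_forall_isModular hES hF
    neronLattice_commensurable_of_isIsogenous_holds

/-- Granted modularity (2) alone, the target fact is *equivalent* to the rational Manin
constant statement `IsNewformOf.exists_maninConstant_ne_zero` — the honest form of "what is
left of (6) once (2) is known". [cite: BCDTJAMS2001, p. 845, (2) ⇒ (6)] -/
theorem nonempty_modularParametrizationData_iff_exists_maninConstant_ne_zero
    (h₁ : exists_isNewformOf) :
    nonempty_modularParametrizationData ↔ IsNewformOf.exists_maninConstant_ne_zero :=
  ⟨exists_maninConstant_ne_zero_of_nonempty_modularParametrizationData,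
    nonempty_modularParametrizationData_of_exists_isNewformOf h₁⟩

end Equivalence

end Literature.NumberTheory.EllipticCurves.ModularForms

end
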